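import Summits.ValiantsHypothesis.ValiantsHypothesis.Theorems.LacunarySymmetroidMatrixDescartesPivotTwoFiveTen
import Summits.ValiantsHypothesis.ValiantsHypothesis.Theorems.LacunarySymmetroidMatrixDescartesPivotTwoSixTwelve

/-!
# `MatrixDescartes` (stmt-ValiantsHypothesis-18050) — the NSD-pivot hypothesis ABSORBS into one extra letter:
# every pivot pencil of index `≤ q` IS an NSD-pivot pencil with one more PSD letter at the pivot exponent, same determinant

HONEST FRAMING.  Cell `pub-symmetroid`, seat `val-sym-mdr-p2` (gen 11); helper file `--supports` the crux
`Theses.LacunarySymmetroid.MatrixDescartes` (OPEN), NO closure claim.  Ninth file of the session's NSD-pivot series and a CORRECTION OF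
THE SESSION'S OWN LOCATED QUESTION («is `sup_K Z₊ = 8` for NSD pivots at `n = 2`?», memo NSD-PIVOT-COLUMN.md §3 and the docstrings of
`…NsdPivotSharp` / `…NsdPivotThreeSix`, always printed as OPEN, never asserted): the answer is **NO, trivially** — if `J + W Wᵀ ⪰ 0`
(index witness of width `q`) then
  `X^e J + ∑ₖ X^{dₖ} Pₖ = X^e · (−W Wᵀ) + X^e · (J + W Wᵀ) + ∑ₖ X^{dₖ} Pₖ`,
a pivot pencil with NEGATIVE SEMIDEFINITE pivot `−W Wᵀ` and `K + 1` PSD letters (the extra one at the pivot exponent), with the same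
determinant (**`pivotPosRoots_absorb`**).  Hence the NSD-pivot column at `K + 1` letters dominates the whole pivot column at `K` letters
(**`exists_nsd_of_not_pivotRootLawAt`**), and the tree's index-one objects give at `n = 2`: `K = 6` NSD letters ⇒ `Z₊ ≥ 10`
(from `not_pivotRootLawAt_two_five_one_nine`, val-sym-mdr-p2 g8) and `K = 7` ⇒ `Z₊ ≥ 12` (from `not_pivotRootLawAt_two_six_one_eleven`):
**`not_nsdPivotLaw_two_nine`**, **`not_nsdPivotLaw_two_eleven`**.  So «`J ⪯ 0`» has NO K-free content at all; what the session's
objects (`…NsdPivotSix/Sharp/ThreeSix/CommutingFive`) add beyond this bookkeeping is that the letters there AVOID the pivot exponent and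
are few (`2K` attained with `K = 3, 4` letters off the pivot exponent; `5` with four COMMUTING letters).  (Letters off the pivot exponent do
not change the picture asymptotically: after `X ↦ X^N` a letter at exponent `e ± 1` is nearly constant on the root window — paper remark,
not formalised.)  Nothing here bears on `MatrixDescartes` in its window, on `DoorA26` / `DoorA34`, on the cell's registers, or on `VP ≠ VNP`.

[folklore] Bookkeeping (`Fin.cons`, `Fin.sum_univ_succ`) + Mathlib `Matrix.posSemidef_self_mul_conjTranspose`.
-/

-- `Summit.ValiantsHypothesis.ValiantsHypothesis.…` repeats a component by the D-0017 layout
-- (single-conjunct summit), which the `dupNamespace` linter flags; the name is mandated.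
set_option linter.dupNamespace false

namespace Summit.ValiantsHypothesis.ValiantsHypothesis.Theorems.LacunarySymmetroidMatrixDescartes.Pivot

open scoped BigOperators Matrix
open Polynomial

namespace NsdAbsorb

variable {m K q : ℕ}

/-- `W Wᵀ ⪰ 0` for a real matrix `W`. [folklore] -/
theorem posSemidef_mul_transpose_self (W : Matrix (Fin m) (Fin q) ℝ) : (W * Wᵀ).PosSemidef := by
  simpa using Matrix.posSemidef_self_mul_conjTranspose W

/-- The absorbed pencil has the SAME matrix polynomial: `X^e(−WWᵀ) + [X^e(J + WWᵀ) + ∑ X^{dₖ}Pₖ] = X^e J + ∑ X^{dₖ}Pₖ`. [folklore] -/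
theorem pencil_absorb (e : ℕ) (d : Fin K → ℕ) (J : Matrix (Fin m) (Fin m) ℝ) (P : Fin K → Matrix (Fin m) (Fin m) ℝ)
    (W : Matrix (Fin m) (Fin q) ℝ) :
    ((X : ℝ[X]) ^ e) • (-(W * Wᵀ)).map Polynomial.C
        + ∑ k, ((X : ℝ[X]) ^ (Fin.cons e d : Fin (K + 1) → ℕ) k)
          • ((Fin.cons (J + W * Wᵀ) P : Fin (K + 1) → Matrix (Fin m) (Fin m) ℝ) k).map Polynomial.C
      = ((X : ℝ[X]) ^ e) • J.map Polynomial.C + ∑ k, ((X : ℝ[X]) ^ d k) • (P k).map Polynomial.C := by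
  rw [Fin.sum_univ_succ]
  simp only [Fin.cons_zero, Fin.cons_succ]
  ext i j
  simp only [Matrix.add_apply, Matrix.smul_apply, Matrix.map_apply, Matrix.neg_apply, map_neg, map_add, smul_eq_mul]
  ring

/-- **ABSORPTION**: the positive-root count is unchanged. [folklore] -/
theorem pivotPosRoots_absorb (e : ℕ) (d : Fin K → ℕ) (J : Matrix (Fin m) (Fin m) ℝ) (P : Fin K → Matrix (Fin m) (Fin m) ℝ)
    (W : Matrix (Fin m) (Fin q) ℝ) :
    pivotPosRoots e (Fin.cons e d : Fin (K + 1) → ℕ) (-(W * Wᵀ))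
        (Fin.cons (J + W * Wᵀ) P : Fin (K + 1) → Matrix (Fin m) (Fin m) ℝ) = pivotPosRoots e d J P := by
  unfold pivotPosRoots
  rw [pencil_absorb]

/-- The new pivot `−W Wᵀ` is negative semidefinite. [folklore] -/
theorem neg_pivot_posSemidef (W : Matrix (Fin m) (Fin q) ℝ) : (-(-(W * Wᵀ))).PosSemidef := by
  rw [neg_neg]; exact posSemidef_mul_transpose_self W

/-- The new pivot `−W Wᵀ` is symmetric. [folklore] -/
theorem neg_pivot_isSymm (W : Matrix (Fin m) (Fin q) ℝ) : (-(W * Wᵀ)).IsSymm := by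
  have h : (W * Wᵀ).IsSymm := by
    unfold Matrix.IsSymm; rw [Matrix.transpose_mul, Matrix.transpose_transpose]
  exact h.neg

/-- The letters of the absorbed pencil are PSD (the new one is `J + W Wᵀ ⪰ 0` by the index hypothesis). [folklore] -/
theorem letters_posSemidef {J : Matrix (Fin m) (Fin m) ℝ} {P : Fin K → Matrix (Fin m) (Fin m) ℝ} {W : Matrix (Fin m) (Fin q) ℝ}
    (hP : ∀ k, (P k).PosSemidef) (hW : (J + W * Wᵀ).PosSemidef) :
    ∀ k : Fin (K + 1), ((Fin.cons (J + W * Wᵀ) P : Fin (K + 1) → Matrix (Fin m) (Fin m) ℝ) k).PosSemidef := by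
  intro k
  refine Fin.cases ?_ (fun i => ?_) k
  · simpa using hW
  · simpa using hP i

end NsdAbsorb

open NsdAbsorb in
/-- **THE NSD COLUMN AT `K + 1` LETTERS DOMINATES THE WHOLE PIVOT COLUMN AT `K` LETTERS**: if a pivot row `PivotRootLawAt m K q B` fails,
then some `m × m` pivot pencil with a negative semidefinite pivot letter and `K + 1` PSD letters has `> B` positive roots. [folklore] -/
theorem exists_nsd_of_not_pivotRootLawAt {m K q B : ℕ} (h : ¬ PivotRootLawAt m K q B) :
    ∃ (e : ℕ) (d : Fin (K + 1) → ℕ) (J : Matrix (Fin m) (Fin m) ℝ) (P : Fin (K + 1) → Matrix (Fin m) (Fin m) ℝ),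
      J.IsSymm ∧ (-J).PosSemidef ∧ (∀ k, (P k).PosSemidef) ∧ B < pivotPosRoots e d J P := by
  unfold PivotRootLawAt at h
  simp only [not_forall, not_le, exists_prop] at h
  obtain ⟨e, d, J, P, _hJ, hP, ⟨W, hW⟩, hlt⟩ := h
  exact ⟨e, Fin.cons e d, -(W * Wᵀ), Fin.cons (J + W * Wᵀ) P, neg_pivot_isSymm W, neg_pivot_posSemidef W,
    letters_posSemidef hP hW, by rw [pivotPosRoots_absorb]; exact hlt⟩

/-- **`n = 2`, `K = 6` NSD letters: `Z₊ ≥ 10`** (absorbing val-sym-mdr-p2 g8's `(2,5)` index-one TEN): the bound `9` fails. [folklore] -/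
theorem not_nsdPivotLaw_two_nine :
    ¬ (∀ (e : ℕ) (d : Fin 6 → ℕ) (J : Matrix (Fin 2) (Fin 2) ℝ) (P : Fin 6 → Matrix (Fin 2) (Fin 2) ℝ),
        J.IsSymm → (-J).PosSemidef → (∀ k, (P k).PosSemidef) → pivotPosRoots e d J P ≤ 9) := by
  intro h
  obtain ⟨e, d, J, P, hJ, hN, hP, hlt⟩ := exists_nsd_of_not_pivotRootLawAt not_pivotRootLawAt_two_five_one_nine
  exact absurd (h e d J P hJ hN hP) (by omega)

/-- **`n = 2`, `K = 7` NSD letters: `Z₊ ≥ 12`** (absorbing the `(2,6)` index-one TWELVE): in particular the session's located question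
«is `8` a K-free ceiling for NSD pivots at `n = 2`?» has the answer NO. [folklore] -/
theorem not_nsdPivotLaw_two_eleven :
    ¬ (∀ (e : ℕ) (d : Fin 7 → ℕ) (J : Matrix (Fin 2) (Fin 2) ℝ) (P : Fin 7 → Matrix (Fin 2) (Fin 2) ℝ),
        J.IsSymm → (-J).PosSemidef → (∀ k, (P k).PosSemidef) → pivotPosRoots e d J P ≤ 11) := by
  intro h
  obtain ⟨e, d, J, P, hJ, hN, hP, hlt⟩ := exists_nsd_of_not_pivotRootLawAt not_pivotRootLawAt_two_six_one_eleven
  exact absurd (h e d J P hJ hN hP) (by omega)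

end Summit.ValiantsHypothesis.ValiantsHypothesis.Theorems.LacunarySymmetroidMatrixDescartes.Pivot
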